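import Literature.NumberTheory.EllipticCurves.PeriodIndexObstructionBaseChange
import Literature.NumberTheory.GaloisRepresentations.BrauerHassePrinciple
import HarnessLib

/-!
# Cassels' theorem `I = P` on `Ш`: the discharge

`Proofs`-style file (theorems only) closing the named fact
`Literature.NumberTheory.EllipticCurves.Cassels1962_index_eq_period_of_mem_sha` (`PeriodIndex.lean`):
for an elliptic curve `E` over a number field `K` and `η ∈ Ш(E/K)`, the index of `η` equals its
period.

The printed proof (Clark 2006, Prop. 6, second proof = Clark–Sharif 2010 §2 (3); Cassels 1962)
was formalized in `PeriodIndexCassels`, `PeriodIndexRationalDivisor`, `PeriodIndexObstruction`,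
`PeriodIndexObstructionLocal` and `PeriodIndexObstructionBaseChange` up to its one
class-field-theoretic input, the Hasse principle for `H²(K, K̄ˣ)` (Albert–Brauer–Hasse–Noether,
`Br(K) ↪ ⊕_v Br(K_v)`), isolated there as the hypothesis of
`Cassels1962_index_eq_period_of_mem_sha_of_hassePrinciple`.  That input is now the tree's theorem
`Literature.NumberTheory.GaloisRepresentations.twoCocycle_cob_of_locallyTrivial`
(`BrauerHassePrinciple.lean`, from Hasse's norm theorem for cyclic extensions and the tree's
continuous cohomology); this file converts between the two cochain dialects (`K̄`-valued nowhere
vanishing cochains with `closureEmb`/`resGal`, versus `K̄ˣ`-valued cochains with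
`absClosureEmbedding`/`absGaloisRestrict` — the same maps, `resGal_eq_absGaloisRestrict`) and
concludes.

## References

* J. W. S. Cassels, *Arithmetic on curves of genus 1. IV. Proof of the Hauptvermutung*, J. reine
  angew. Math. 211 (1962) 95–112.
* P. L. Clark, *There are genus one curves of every index over every number field*, J. reine
  angew. Math. 594 (2006) 201–206, Prop. 6 with Prop. 5(a). [Clark2006Crelle]
* P. L. Clark, S. Sharif, *Period, index and potential Ш*, Algebra & Number Theory 4 (2010)
  151–174, §1.3, §2 (3), §3.7 (ii); arXiv:0811.3019. [ClarkSharif2010]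
* J. W. S. Cassels, A. Fröhlich (eds.), *Algebraic Number Theory* (1967), Ch. VII (Tate),
  §9.6, §10, §11.2. [CasselsFrohlichANT1967]
-/

noncomputable section

universe u

namespace Literature.NumberTheory.EllipticCurves

open GaloisRepresentations NumberField IsDedekindDomain

/-- **The Hasse principle for `H²(K, K̄ˣ)` in the `K̄`-valued cochain dialect of
`PeriodIndexObstructionBaseChange`**: a locally constant nowhere-vanishing `2`-cocycle
`e : Γ_K × Γ_K → K̄` which is a continuous coboundary over every completion is a continuous
coboundary (`twoCocycle_cob_of_locallyTrivial` for the unit-valued cocycle `e`).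
[cite: CasselsFrohlichANT1967, Ch. VII §9.6 and §10 (Brauer–Hasse–Noether)] -/
theorem hassePrinciple_twoCocycle {K : Type u} [Field K] [NumberField K]
    (e : Field.absoluteGaloisGroup K → Field.absoluteGaloisGroup K → AlgebraicClosure K)
    (hlc : IsLocallyConstant (fun p : Field.absoluteGaloisGroup K × Field.absoluteGaloisGroup K ↦ e p.1 p.2))
    (he0 : ∀ σ τ, e σ τ ≠ 0)
    (hcoc : ∀ σ τ υ, e σ τ * e (σ * τ) υ = σ • e τ υ * e σ (τ * υ))
    (hfin : ∀ v : HeightOneSpectrum (𝓞 K),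
      ∃ b : Field.absoluteGaloisGroup (v.adicCompletion K) → AlgebraicClosure (v.adicCompletion K),
        IsLocallyConstant b ∧ (∀ x, b x ≠ 0) ∧
          ∀ x y, closureEmb (K := K) (v.adicCompletion K)
              (e (resGal (K := K) (v.adicCompletion K) x) (resGal (K := K) (v.adicCompletion K) y)) =
            b x * x • b y / b (x * y))
    (hinf : ∀ w : InfinitePlace K,
      ∃ b : Field.absoluteGaloisGroup w.Completion → AlgebraicClosure w.Completion,
        IsLocallyConstant b ∧ (∀ x, b x ≠ 0) ∧
          ∀ x y, closureEmb (K := K) w.Completion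
              (e (resGal (K := K) w.Completion x) (resGal (K := K) w.Completion y)) =
            b x * x • b y / b (x * y)) :
    ∃ b : Field.absoluteGaloisGroup K → AlgebraicClosure K, IsLocallyConstant b ∧ (∀ σ, b σ ≠ 0) ∧
      ∀ σ τ, e σ τ = b σ * σ • b τ / b (σ * τ) := by
  -- the unit-valued cocycle
  set eU : Field.absoluteGaloisGroup K → Field.absoluteGaloisGroup K → (AlgebraicClosure K)ˣ :=
    fun σ τ ↦ Units.mk0 (e σ τ) (he0 σ τ) with heU
  have hvalU : ∀ σ τ, ((eU σ τ : (AlgebraicClosure K)ˣ) : AlgebraicClosure K) = e σ τ := fun σ τ ↦ rfl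
  have hlcU : IsLocallyConstant (fun p : Field.absoluteGaloisGroup K × Field.absoluteGaloisGroup K ↦ eU p.1 p.2) :=
    IsLocallyConstant.desc _ (Units.val : (AlgebraicClosure K)ˣ → AlgebraicClosure K) hlc Units.val_injective
  have hcocU : ∀ σ τ υ, eU σ τ * eU (σ * τ) υ = σ • eU τ υ * eU σ (τ * υ) := fun σ τ υ ↦
    Units.ext (by rw [Units.val_mul, Units.val_mul, Units.coe_smul, hvalU, hvalU, hvalU, hvalU]; exact hcoc σ τ υ)
  -- local triviality in unit form
  have hfinU : ∀ v : HeightOneSpectrum (𝓞 K),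
      ∃ b : Field.absoluteGaloisGroup (v.adicCompletion K) → (AlgebraicClosure (v.adicCompletion K))ˣ,
        IsLocallyConstant b ∧ ∀ x y,
          Units.map (absClosureEmbedding K (v.adicCompletion K) :
              AlgebraicClosure K →* AlgebraicClosure (v.adicCompletion K))
            (eU (absGaloisRestrict K (v.adicCompletion K) x) (absGaloisRestrict K (v.adicCompletion K) y)) =
          b x * x • b y / b (x * y) := fun v ↦ by
    obtain ⟨b, hb, hb0, hbe⟩ := hfin v
    refine ⟨fun x ↦ Units.mk0 (b x) (hb0 x),
      IsLocallyConstant.desc _ (Units.val : (AlgebraicClosure (v.adicCompletion K))ˣ → _) hb Units.val_injective,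
      fun x y ↦ Units.ext ?_⟩
    rw [Units.val_div_eq_div_val, Units.val_mul, Units.coe_smul, Units.coe_map, MonoidHom.coe_coe, hvalU]
    exact hbe x y
  have hinfU : ∀ w : InfinitePlace K,
      ∃ b : Field.absoluteGaloisGroup w.Completion → (AlgebraicClosure w.Completion)ˣ,
        IsLocallyConstant b ∧ ∀ x y,
          Units.map (absClosureEmbedding K w.Completion : AlgebraicClosure K →* AlgebraicClosure w.Completion)
            (eU (absGaloisRestrict K w.Completion x) (absGaloisRestrict K w.Completion y)) =
          b x * x • b y / b (x * y) := fun w ↦ by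
    obtain ⟨b, hb, hb0, hbe⟩ := hinf w
    refine ⟨fun x ↦ Units.mk0 (b x) (hb0 x),
      IsLocallyConstant.desc _ (Units.val : (AlgebraicClosure w.Completion)ˣ → _) hb Units.val_injective,
      fun x y ↦ Units.ext ?_⟩
    rw [Units.val_div_eq_div_val, Units.val_mul, Units.coe_smul, Units.coe_map, MonoidHom.coe_coe, hvalU]
    exact hbe x y
  -- the Hasse principle
  obtain ⟨bU, hbU, hbUe⟩ := twoCocycle_cob_of_locallyTrivial eU hlcU hcocU hfinU hinfU
  refine ⟨fun σ ↦ (bU σ : AlgebraicClosure K), hbU.comp _, fun σ ↦ (bU σ).ne_zero, fun σ τ ↦ ?_⟩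
  rw [← hvalU, hbUe, Units.val_div_eq_div_val, Units.val_mul, Units.coe_smul]

/-- **Cassels 1962: period equals index on `Ш`** — the discharge of
`Cassels1962_index_eq_period_of_mem_sha`: for an elliptic curve `E` over a number field `K` and
`η ∈ Ш(E/K)`, `index η = period η`.  Proof: the printed proof of Clark 2006, Prop. 6 (with
Prop. 5(a); Clark–Sharif §2 (3)) formalized in `Cassels1962_index_eq_period_of_mem_sha_of_hassePrinciple`,
fed with the Hasse principle for `H²(K, K̄ˣ)` (`hassePrinciple_twoCocycle`).
[cite: ClarkSharif2010, §3.7 (ii) and §1.3 (reporting Cassels1962ArithmeticIV)]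
[cite: Clark2006Crelle, Prop. 6 with Prop. 5(a)]
[cite: CasselsFrohlichANT1967, Ch. VII §9.6, §10 (Brauer–Hasse–Noether), §11.2] -/
theorem Cassels1962_index_eq_period_of_mem_sha_holds : Cassels1962_index_eq_period_of_mem_sha.{u} :=
  Cassels1962_index_eq_period_of_mem_sha_of_hassePrinciple
    fun e hlc he0 hcoc hfin hinf ↦ hassePrinciple_twoCocycle e hlc he0 hcoc hfin hinf

end Literature.NumberTheory.EllipticCurves
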